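import Summits.QuantumFields.YangMills.Theorems.AlphaInputsT3ACv3AbelianShapes1D
import HarnessLib

/-!
# `AlphaInputsT3ACv3AbelianShapes1DSums` — STRATEGY B for 2′, (LL) the linear regional lift: THE ONE-DIMENSIONAL SHAPE SYSTEM, part 2 — block sums, supports, bounds, and
# sums over the coarse index at a fixed fine coordinate — lane `pub-balaban3d`, seat alpha-2 (g5)

WHY.  Companion of `…v3AbelianShapes1D` (same objects `c, b, h^θ, g^θ, N` of the cyclic offset).  THIS FILE: ★ the vanishing block sums `Σ_{j<n} g^θ(nb+j) = 0` (what makes every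
corrector of the sibling lift invisible to the tube average), `Σ_{j<n} b(nb+j) = n·[b ≡ 0]`, `Σ_{s<n} c(t+s) = b(t)` (§4); supports (§5); the bounds `|h| ≤ 4/n`, `|g| ≤ 1`, `|N| ≤ 3`
(§6); and the sums over the COARSE index at a fixed fine coordinate (the residues `ρ₀ − n·t (mod N)`, `t < n_c`, are one point per block), giving `Σ_t b = 1`, `Σ_t |g^θ| ≤ 1`,
`Σ_t |h^θ| ≤ 8/n`, `Σ_t |N| ≤ 3` (§7) — the per-coordinate factors of the curl bound of the lift.
HONEST FRAMING.  Elementary real arithmetic; nothing of [B10]∕[7]∕[4] asserted; count-neutral helper toward R3 2′ (`stub_laneRecordsV3`, items 19935∕19936); registry untouched;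
nothing about d = 4, the continuum, or a mass gap.

References: T. Bałaban, Commun. Math. Phys. 102 (1985) 277–309 [Balaban1985Variational] ((8) p.279); CMP 109 (1987) 249–301 [Balaban1987RG1] ((0.4) p.253).
-/

set_option autoImplicit false

noncomputable section

namespace Summit.QuantumFields.YangMills.Theorems.AbelianEML.Shapes1D

open scoped BigOperators

/-! ## §4 Block sums -/

section Sums

variable {n N nc : ℕ} (hN : N = n * nc) (hnc : 2 ≤ nc) (hn : 1 ≤ n)
include hN hnc hn

/-- Offsets of an aligned window: `(nb + j) mod N = n(b mod n_c) + j` for `j < n`. [folklore] -/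
theorem window_mod {b j : ℕ} (hj : j < n) : (n * b + j) % N = n * (b % nc) + j := by
  have hb : b % nc < nc := Nat.mod_lt _ (by omega)
  have hlt : n * (b % nc) + j < N := by
    rw [hN]
    calc n * (b % nc) + j < n * (b % nc) + n := by omega
      _ = n * (b % nc + 1) := by ring
      _ ≤ n * nc := Nat.mul_le_mul_left _ hb
  rw [Nat.add_mod, hN, Nat.mul_mod_mul_left, ← hN, Nat.mod_eq_of_lt (hj.trans_le (by have := two_n_le hN hnc; omega)),
    Nat.mod_eq_of_lt hlt]

/-- **★ THE CUMULATIVES HAVE ZERO SUM OVER EVERY BLOCK**: `Σ_{j<n} g^θ(nb + j) = 0`. [cite: Balaban1985Variational, (8) p.279] -/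
theorem sum_block_gS (θ : Bool) (b : ℕ) : ∑ j ∈ Finset.range n, gS θ n N (n * b + j) = 0 := by
  have hb : b % nc < nc := Nat.mod_lt _ (by omega)
  have key : ∀ j ∈ Finset.range n, gS θ n N (n * b + j) =
      if θ then (if b % nc = 1 then -Gprof n (n - 1 - j) else 0) else (if b % nc = 0 then Gprof n j else 0) := by
    intro j hj
    rw [Finset.mem_range] at hj
    simp only [gS, per, window_mod hN hnc hn hj]
    cases θ
    · simp only [Bool.false_eq_true, if_false]
      by_cases h0 : b % nc = 0
      · rw [h0, if_pos (by omega), if_pos rfl, mul_zero, zero_add]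
      · have hcond : ¬ (n * (b % nc) + j < n) := by
          have : 1 ≤ b % nc := Nat.one_le_iff_ne_zero.mpr h0
          nlinarith
        rw [if_neg hcond, if_neg h0]
    · simp only [if_true]
      by_cases h1 : b % nc = 1
      · have e : 2 * n - 1 - (n * 1 + j) = n - 1 - j := by omega
        rw [h1, if_pos ⟨by omega, by omega⟩, if_pos rfl, e]
      · have hcond : ¬ (n ≤ n * (b % nc) + j ∧ n * (b % nc) + j < 2 * n) := by
          rintro ⟨ha, hb'⟩
          rcases Nat.lt_or_ge (b % nc) 1 with h | h
          · have h00 : b % nc = 0 := by omega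
            rw [h00] at ha; omega
          · have h2 : 2 ≤ b % nc := by omega
            nlinarith
        rw [if_neg hcond, if_neg h1]
  rw [Finset.sum_congr rfl key]
  cases θ
  · simp only [Bool.false_eq_true, if_false]
    by_cases h0 : b % nc = 0
    · simp only [h0, if_true]; exact sum_Gprof_self hn
    · simp [h0]
  · simp only [if_true]
    by_cases h1 : b % nc = 1
    · simp only [h1, if_true, Finset.sum_neg_distrib, neg_eq_zero]
      have hrefl := Finset.sum_range_reflect (fun j => Gprof n j) n
      rw [hrefl]
      exact sum_Gprof_self hn
    · simp [h1]

/-- The block indicator sums to `n` over the home block and to `0` over every other block. [folklore] -/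
theorem sum_block_bS (b : ℕ) : ∑ j ∈ Finset.range n, bS n N (n * b + j) = if b % nc = 0 then (n : ℝ) else 0 := by
  have key : ∀ j ∈ Finset.range n, bS n N (n * b + j) = if b % nc = 0 then 1 else 0 := by
    intro j hj
    rw [Finset.mem_range] at hj
    simp only [bS, per, window_mod hN hnc hn hj]
    by_cases h0 : b % nc = 0
    · rw [h0, if_pos (by omega), if_pos rfl]
    · rw [if_neg, if_neg h0]
      have : 1 ≤ b % nc := Nat.one_le_iff_ne_zero.mpr h0
      nlinarith
  rw [Finset.sum_congr rfl key, Finset.sum_const, Finset.card_range, nsmul_eq_mul]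
  split_ifs <;> simp

/-- **Exactly one crossing bond in every window of `n` bonds starting in the home block, none otherwise**: `Σ_{s<n} c(t+s) = b(t)`. [folklore] -/
theorem sum_window_cS (t : ℕ) : ∑ s ∈ Finset.range n, cS n N (t + s) = bS n N t := by
  have h2n := two_n_le hN hnc
  have hN0 : 0 < N := by omega
  set r := t % N with hr
  have hrN : r < N := Nat.mod_lt _ hN0
  have key : ∀ s ∈ Finset.range n, cS n N (t + s) = if s = n - 1 - r ∧ r < n then 1 else 0 := by
    intro s hs
    rw [Finset.mem_range] at hs
    simp only [cS, per]
    rw [Nat.add_mod, ← hr, Nat.mod_eq_of_lt (show s < N by omega)]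
    by_cases hw : r + s < N
    · rw [Nat.mod_eq_of_lt hw]
      by_cases h : r + s = n - 1
      · rw [if_pos h, if_pos ⟨by omega, by omega⟩]
      · rw [if_neg h, if_neg (by omega)]
    · rw [Nat.mod_eq_sub_mod (by omega), Nat.mod_eq_of_lt (by omega), if_neg (by omega), if_neg (by omega)]
  rw [Finset.sum_congr rfl key]
  simp only [bS, per, ← hr]
  by_cases h : r < n
  · simp only [h, and_true, if_true]
    rw [Finset.sum_ite_eq' (Finset.range n) (n - 1 - r) (fun _ => (1 : ℝ))]
    rw [if_pos (Finset.mem_range.mpr (by omega))]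
  · simp [h]

end Sums

/-! ## §5 Supports -/

section Supports

variable {n N : ℕ}

/-- `h⁰` lives on the bonds touching the home block: `h⁰(ρ) ≠ 0 → ρ mod N < n`. [folklore] -/
theorem hS_false_ne_zero {ρ : ℕ} (h : hS false n N ρ ≠ 0) : ρ % N < n := by
  simp only [hS, per, Bool.false_eq_true, if_false] at h
  by_contra hc; exact h (if_neg hc)
/-- `h¹` lives on the bonds touching the next block: `h¹(ρ) ≠ 0 → n − 1 ≤ ρ mod N ≤ 2n − 2`. [folklore] -/
theorem hS_true_ne_zero {ρ : ℕ} (h : hS true n N ρ ≠ 0) : n - 1 ≤ ρ % N ∧ ρ % N ≤ 2 * n - 2 := by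
  simp only [hS, per, if_true] at h
  by_contra hc; exact h (if_neg hc)
/-- `g⁰` lives on the home block. [folklore] -/
theorem gS_false_ne_zero {ρ : ℕ} (h : gS false n N ρ ≠ 0) : ρ % N < n := by
  simp only [gS, per, Bool.false_eq_true, if_false] at h
  by_contra hc; exact h (if_neg hc)
/-- `g¹` lives on the next block. [folklore] -/
theorem gS_true_ne_zero {ρ : ℕ} (h : gS true n N ρ ≠ 0) : n ≤ ρ % N ∧ ρ % N < 2 * n := by
  simp only [gS, per, if_true] at h
  by_contra hc; exact h (if_neg hc)
/-- The crossing bond: `c(ρ) ≠ 0 → ρ mod N = n − 1`. [folklore] -/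
theorem cS_ne_zero {ρ : ℕ} (h : cS n N ρ ≠ 0) : ρ % N = n - 1 := by
  simp only [cS, per] at h
  by_contra hc; exact h (if_neg hc)

end Supports

/-! ## §6 Bounds -/

section Bounds

variable {n N : ℕ} (hn : 1 ≤ n)
include hn

/-- `|h^θ| ≤ 4/n`. [folklore] -/
theorem abs_hS_le (θ : Bool) (ρ : ℕ) : |hS θ n N ρ| ≤ 4 / (n : ℝ) := by
  have h0 : (0 : ℝ) ≤ 4 / (n : ℝ) := by positivity
  simp only [hS, per]
  cases θ
  · simp only [Bool.false_eq_true, if_false]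
    split_ifs with h
    · exact abs_hprof_le hn h
    · simpa using h0
  · simp only [if_true]
    split_ifs with h
    · exact abs_hprof_le hn (by omega)
    · simpa using h0

/-- `|g^θ| ≤ 1`. [folklore] -/
theorem abs_gS_le (θ : Bool) (ρ : ℕ) : |gS θ n N ρ| ≤ 1 := by
  simp only [gS, per]
  cases θ
  · simp only [Bool.false_eq_true, if_false]
    split_ifs with h
    · exact abs_Gprof_le hn h.le
    · simp
  · simp only [if_true]
    split_ifs with h
    · rw [abs_neg]; exact abs_Gprof_le hn (by omega)
    · simp

/-- `0 ≤ b ≤ 1`. [folklore] -/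
theorem bS_mem (ρ : ℕ) : 0 ≤ bS n N ρ ∧ bS n N ρ ≤ 1 := by
  have _ := hn
  simp only [bS, per]; split_ifs <;> norm_num

/-- `0 ≤ c ≤ 1`. [folklore] -/
theorem cS_mem (ρ : ℕ) : 0 ≤ cS n N ρ ∧ cS n N ρ ≤ 1 := by
  have _ := hn
  simp only [cS, per]; split_ifs <;> norm_num

/-- `|N| ≤ 3`. [folklore] -/
theorem abs_NS_le (ρ : ℕ) : |NS n N ρ| ≤ 3 := by
  have h1 := bS_mem (N := N) hn ρ
  have h2 := abs_gS_le (N := N) hn false (ρ + n)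
  have h3 := abs_gS_le (N := N) hn false ρ
  rw [abs_le] at h2 h3 ⊢
  simp only [NS]
  constructor <;> linarith [h1.1, h1.2, h2.1, h2.2, h3.1, h3.2]

end Bounds

/-! ## §7 Sums over the coarse index (one fine coordinate fixed) -/

section Coarse

variable {n N nc : ℕ} (hN : N = n * nc) (hnc : 2 ≤ nc) (hn : 1 ≤ n)
include hN hnc hn

omit hN hnc hn in
/-- Rotating a sum over a full period. [folklore] -/
theorem sum_range_rotate (G : ℕ → ℝ) {m : ℕ} (hm : 0 < m) : ∀ a : ℕ,
    ∑ t ∈ Finset.range m, G ((a + t) % m) = ∑ t ∈ Finset.range m, G t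
  | 0 => Finset.sum_congr rfl fun t ht => by rw [zero_add, Nat.mod_eq_of_lt (Finset.mem_range.mp ht)]
  | a + 1 => by
    have ih := sum_range_rotate G hm a
    have h1 : ∑ t ∈ Finset.range m, G ((a + 1 + t) % m) = ∑ t ∈ Finset.range m, (fun u => G ((a + u) % m)) (t + 1) :=
      Finset.sum_congr rfl fun t _ => by simp only [add_assoc, add_comm 1 t]
    rw [h1, ← ih]
    have h2 := Finset.sum_range_succ (fun u => G ((a + u) % m)) m
    have h3 := Finset.sum_range_succ' (fun u => G ((a + u) % m)) m
    simp only [Nat.add_mod_right, add_zero] at h2 h3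
    linarith

/-- **THE RESIDUES `ρ₀ − n·t (mod N)`, `t < n_c`, ARE THE `n_c` POINTS `n·b + (ρ₀ mod n)`**: a periodic shape summed over the coarse index at a fixed fine coordinate is its
profile summed over one point per block. [folklore] -/
theorem sum_coarse_per (F : ℕ → ℝ) {ρ₀ : ℕ} (hρ : ρ₀ < N) :
    ∑ t ∈ Finset.range nc, per N F (ρ₀ + (N - n * t)) = ∑ b ∈ Finset.range nc, F (n * b + ρ₀ % n) := by
  have hnc0 : 0 < nc := by omega
  set q := ρ₀ / n with hq
  set r := ρ₀ % n with hr
  have hqr : ρ₀ = n * q + r := (Nat.div_add_mod ρ₀ n).symm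
  have hrn : r < n := Nat.mod_lt _ (by omega)
  have hq' : q < nc := by rw [hq, Nat.div_lt_iff_lt_mul (by omega)]; rw [hN] at hρ; linarith
  -- each term is the profile at an aligned window
  have key : ∀ t ∈ Finset.range nc, per N F (ρ₀ + (N - n * t)) = F (n * ((q + 1 + (nc - 1 - t)) % nc) + r) := by
    intro t ht
    rw [Finset.mem_range] at ht
    have e : ρ₀ + (N - n * t) = n * (q + 1 + (nc - 1 - t)) + r := by
      rw [hqr, hN]
      have : n * t ≤ n * nc := Nat.mul_le_mul_left _ ht.le
      zify [this, ht.le, (show 1 ≤ nc by omega), (show t ≤ nc - 1 by omega)]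
      ring
    simp only [per]
    rw [e, window_mod hN hnc hn hrn]
  rw [Finset.sum_congr rfl key]
  have hrefl := Finset.sum_range_reflect (fun t => F (n * ((q + 1 + t) % nc) + r)) nc
  rw [hrefl]
  exact sum_range_rotate (fun b => F (n * b + r)) hnc0 (q + 1)

omit hN hnc hn in
/-- A sum over `range m` read through `ZMod m`. [folklore] -/
theorem sum_zmod_val (f : ℕ → ℝ) {m : ℕ} [NeZero m] : ∑ t : ZMod m, f t.val = ∑ t ∈ Finset.range m, f t := by
  obtain ⟨m, rfl⟩ : ∃ m', m = m' + 1 := ⟨m - 1, by have := NeZero.pos m; omega⟩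
  exact Fin.sum_univ_eq_sum_range (fun t => f t) (m + 1)

/-- The block indicator summed over the coarse index is `1`. [folklore] -/
theorem sum_coarse_bS {ρ₀ : ℕ} (hρ : ρ₀ < N) : ∑ t ∈ Finset.range nc, bS n N (ρ₀ + (N - n * t)) = 1 := by
  rw [bS, sum_coarse_per hN hnc hn _ hρ]
  have hrn : ρ₀ % n < n := Nat.mod_lt _ (by omega)
  have key : ∀ b ∈ Finset.range nc, (if n * b + ρ₀ % n < n then (1 : ℝ) else 0) = if b = 0 then 1 else 0 := by
    intro b _
    by_cases hb : b = 0
    · rw [if_pos (by rw [hb]; omega), if_pos hb]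
    · have h1b : 1 ≤ b := Nat.one_le_iff_ne_zero.mpr hb
      have : n * 1 ≤ n * b := Nat.mul_le_mul_left n h1b
      rw [if_neg (by omega), if_neg hb]
  rw [Finset.sum_congr rfl key, Finset.sum_ite_eq' (Finset.range nc) 0 (fun _ => (1 : ℝ)), if_pos (Finset.mem_range.mpr (by omega))]

/-- The cumulatives summed (in absolute value) over the coarse index are at most `1`. [folklore] -/
theorem sum_coarse_abs_gS_le (θ : Bool) {ρ₀ : ℕ} (hρ : ρ₀ < N) : ∑ t ∈ Finset.range nc, |gS θ n N (ρ₀ + (N - n * t))| ≤ 1 := by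
  have hrn : ρ₀ % n < n := Nat.mod_lt _ (by omega)
  have habs : ∀ t, |gS θ n N (ρ₀ + (N - n * t))| = per N (fun x => |(fun r => if θ then (if n ≤ r ∧ r < 2 * n then -Gprof n (2 * n - 1 - r) else 0)
      else (if r < n then Gprof n r else 0)) x|) (ρ₀ + (N - n * t)) := fun t => rfl
  simp only [habs]
  rw [sum_coarse_per hN hnc hn _ hρ]
  cases θ
  · simp only [Bool.false_eq_true, if_false]
    have key : ∀ b ∈ Finset.range nc, |(if n * b + ρ₀ % n < n then Gprof n (n * b + ρ₀ % n) else 0)| = if b = 0 then |Gprof n (ρ₀ % n)| else 0 := by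
      intro b _
      by_cases hb : b = 0
      · rw [hb, if_pos (by omega), if_pos rfl, mul_zero, zero_add]
      · have h1b : 1 ≤ b := Nat.one_le_iff_ne_zero.mpr hb
        have : n * 1 ≤ n * b := Nat.mul_le_mul_left n h1b
        rw [if_neg (by omega), if_neg hb, abs_zero]
    rw [Finset.sum_congr rfl key, Finset.sum_ite_eq' (Finset.range nc) 0, if_pos (Finset.mem_range.mpr (by omega))]
    exact abs_Gprof_le hn hrn.le
  · simp only [if_true]
    have key : ∀ b ∈ Finset.range nc, |(if n ≤ n * b + ρ₀ % n ∧ n * b + ρ₀ % n < 2 * n then -Gprof n (2 * n - 1 - (n * b + ρ₀ % n)) else 0)| =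
        if b = 1 then |Gprof n (n - 1 - ρ₀ % n)| else 0 := by
      intro b _
      by_cases hb : b = 1
      · have e : 2 * n - 1 - (n * 1 + ρ₀ % n) = n - 1 - ρ₀ % n := by omega
        rw [hb, if_pos ⟨by omega, by omega⟩, if_pos rfl, e, abs_neg]
      · have hcond : ¬ (n ≤ n * b + ρ₀ % n ∧ n * b + ρ₀ % n < 2 * n) := by
          rintro ⟨h1, h2⟩
          rcases Nat.lt_or_ge b 1 with h | h
          · have hb0 : b = 0 := by omega
            rw [hb0] at h1; omega
          · have h2b : 2 ≤ b := by omega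
            have : n * 2 ≤ n * b := Nat.mul_le_mul_left n h2b
            omega
        rw [if_neg hcond, if_neg hb, abs_zero]
    rw [Finset.sum_congr rfl key, Finset.sum_ite_eq' (Finset.range nc) 1, if_pos (Finset.mem_range.mpr (by omega))]
    exact abs_Gprof_le hn (by omega)

/-- The bond profiles summed (in absolute value) over the coarse index are at most `8/n`. [folklore] -/
theorem sum_coarse_abs_hS_le (θ : Bool) {ρ₀ : ℕ} (hρ : ρ₀ < N) : ∑ t ∈ Finset.range nc, |hS θ n N (ρ₀ + (N - n * t))| ≤ 8 / (n : ℝ) := by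
  have hrn : ρ₀ % n < n := Nat.mod_lt _ (by omega)
  have h4 : (0 : ℝ) ≤ 4 / (n : ℝ) := by positivity
  have habs : ∀ t, |hS θ n N (ρ₀ + (N - n * t))| = per N (fun x => |(fun r => if θ then (if n - 1 ≤ r ∧ r ≤ 2 * n - 2 then hprof n (2 * n - 2 - r) else 0)
      else (if r < n then hprof n r else 0)) x|) (ρ₀ + (N - n * t)) := fun t => rfl
  simp only [habs]
  rw [sum_coarse_per hN hnc hn _ hρ]
  -- only the blocks `b = 0, 1` can contribute, each by at most `4/n`
  have hterm : ∀ b ∈ Finset.range nc, |(fun r => if θ then (if n - 1 ≤ r ∧ r ≤ 2 * n - 2 then hprof n (2 * n - 2 - r) else 0)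
      else (if r < n then hprof n r else 0)) (n * b + ρ₀ % n)| ≤ if b < 2 then 4 / (n : ℝ) else 0 := by
    intro b _
    by_cases hb : b < 2
    · rw [if_pos hb]
      cases θ
      · simp only [Bool.false_eq_true, if_false]
        split_ifs with h
        · exact abs_hprof_le hn h
        · rw [abs_zero]; exact h4
      · simp only [if_true]
        split_ifs with h
        · exact abs_hprof_le hn (by omega)
        · rw [abs_zero]; exact h4
    · rw [if_neg hb]
      have hb2 : 2 ≤ b := by omega
      have hmul : n * 2 ≤ n * b := Nat.mul_le_mul_left n hb2
      have hbig : 2 * n ≤ n * b + ρ₀ % n := by omega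
      cases θ
      · simp only [Bool.false_eq_true, if_false]; rw [if_neg (by omega), abs_zero]
      · simp only [if_true]; rw [if_neg (by omega), abs_zero]
  refine (Finset.sum_le_sum hterm).trans ?_
  rw [Finset.sum_ite, Finset.sum_const_zero, add_zero, Finset.sum_const, nsmul_eq_mul]
  have hcard : ((Finset.filter (fun b => b < 2) (Finset.range nc)).card : ℝ) ≤ 2 := by
    have : Finset.filter (fun b => b < 2) (Finset.range nc) ⊆ Finset.range 2 := by
      intro b hb; simp only [Finset.mem_filter, Finset.mem_range] at hb ⊢; exact hb.2
    exact_mod_cast (Finset.card_le_card this).trans (by simp)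
  calc ((Finset.filter (fun b => b < 2) (Finset.range nc)).card : ℝ) * (4 / (n : ℝ)) ≤ 2 * (4 / (n : ℝ)) :=
      mul_le_mul_of_nonneg_right hcard h4
    _ = 8 / (n : ℝ) := by ring

/-- The site shape summed (in absolute value) over the coarse index is at most `3`. [folklore] -/
theorem sum_coarse_abs_NS_le {ρ₀ : ℕ} (hρ : ρ₀ < N) : ∑ t ∈ Finset.range nc, |NS n N (ρ₀ + (N - n * t))| ≤ 3 := by
  have hN0 : 0 < N := by have := two_n_le hN hnc; omega
  have hρ' : (ρ₀ + n) % N < N := Nat.mod_lt _ hN0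
  -- the shifted cumulative is the same kind of sum at the fine coordinate `(ρ₀ + n) mod N`
  have hshift : ∀ t ∈ Finset.range nc, gS false n N (ρ₀ + (N - n * t) + n) = gS false n N ((ρ₀ + n) % N + (N - n * t)) := by
    intro t ht
    rw [Finset.mem_range] at ht
    apply gS_congr
    have hle : n * t ≤ N := by rw [hN]; exact Nat.mul_le_mul_left _ ht.le
    rw [show ρ₀ + (N - n * t) + n = (ρ₀ + n) + (N - n * t) by omega]
    exact (Nat.mod_add_mod _ _ _).symm
  have h1 : ∀ t ∈ Finset.range nc, |NS n N (ρ₀ + (N - n * t))| ≤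
      bS n N (ρ₀ + (N - n * t)) + |gS false n N ((ρ₀ + n) % N + (N - n * t))| + |gS false n N (ρ₀ + (N - n * t))| := by
    intro t ht
    rw [NS, hshift t ht]
    have hb := (bS_mem (N := N) hn (ρ₀ + (N - n * t))).1
    calc |bS n N (ρ₀ + (N - n * t)) + gS false n N ((ρ₀ + n) % N + (N - n * t)) - gS false n N (ρ₀ + (N - n * t))|
        ≤ |bS n N (ρ₀ + (N - n * t)) + gS false n N ((ρ₀ + n) % N + (N - n * t))| + |gS false n N (ρ₀ + (N - n * t))| := abs_sub _ _
      _ ≤ |bS n N (ρ₀ + (N - n * t))| + |gS false n N ((ρ₀ + n) % N + (N - n * t))| + |gS false n N (ρ₀ + (N - n * t))| :=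
          add_le_add (abs_add_le _ _) le_rfl
      _ = _ := by rw [abs_of_nonneg hb]
  refine (Finset.sum_le_sum h1).trans ?_
  rw [Finset.sum_add_distrib, Finset.sum_add_distrib, sum_coarse_bS hN hnc hn hρ]
  have h2 := sum_coarse_abs_gS_le hN hnc hn false hρ'
  have h3 := sum_coarse_abs_gS_le hN hnc hn false hρ
  linarith

/-- **The cumulatives have zero box sum over every block, read along the coarse index of a tube**: for every coarse `b`, `Σ_{j<n} g^θ(n·b′ + j) = 0` where the window
`n·b′ + j` is ANY aligned window — restated for the argument form `(nb + j) + (N − n t)`. [folklore] -/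
theorem sum_block_gS_shift (θ : Bool) (b t : ℕ) (ht : t ≤ nc) : ∑ j ∈ Finset.range n, gS θ n N (n * b + j + (N - n * t)) = 0 := by
  have e : ∀ j, n * b + j + (N - n * t) = n * (b + (nc - t)) + j := by
    intro j
    have hle : n * t ≤ n * nc := Nat.mul_le_mul_left _ ht
    rw [hN]; zify [hle, ht]; ring
  simp only [e]
  exact sum_block_gS hN hnc hn θ _

end Coarse

end Summit.QuantumFields.YangMills.Theorems.AbelianEML.Shapes1D

end
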